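import Summits.Ventures.GridStability.Lyapunov.NE39LossySplitLinesCast
import Summits.Ventures.GridStability.Lyapunov.NE39LossySplitLinesRecDualDataA
import Summits.Ventures.GridStability.Lyapunov.NE39LossySplitLinesRecDualDataB
import Literature.Computation.Certificates.PosSemidefDecide
import HarnessLib

/-!
# «NE39-LOSSY-SPLITU-RECORD-CEILING» — kernel file 1 of 2: the tables ARE the Gram products (`Z₁₁ = G1G1ᵀ`, `Z₂₁ = HG1ᵀ`), the
# (D1) matrix `HD = W + Wᵀ` is the formula on the tables, and `HD ⪰ 0` (19 × 19 `LDLᵀ`)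

Cell `gridfusion` (39-bus rung, OBSTRUCTION side); seat gridfusion-lit-6 (g10).  Typed accessors of the witness data on
`S = NE39.splitLurieLinesSystem`'s index types and the kernel decisions that make file `NE39LossySplitLinesRecDual.lean`'s cast identities
go through: `Z11_eqᵣ` / `Z21_eqᵣ` (every entry of the tables `Z11litᵣ` / `Z21tabᵣ` equals the Gram sum over `Fin 19`), `X_eqᵣ`, `BZ_eqᵣ`,
`HD_eqᵣ` (the (D1) matrix entrywise from `AQ`, `BLQ` of `NE39LossySplitLinesCast` BY NAME), `HD_ldlᵣ`.  Nothing here is a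
statement about a grid.
[cite: BoydVandenberghe2004, §5.9.4 (5.97)–(5.98); HornJohnson2013, Thm 7.2.7]
-/

namespace Summit.Ventures.GridStability.Lyapunov.NE39LossySplitLinesRecDual

open Matrix Literature.Computation.Certificates
open Literature.MathematicalPhysics.PowerSystems.LyapunovFunctionFamily
open Summit.Ventures.GridStability.Models
open Summit.Ventures.GridStability.Lyapunov.NE39LossySplitLines (e1 AQ CQ BLQ)

/-! ### Typed accessors -/

/-- `G1` on the typed state index (rows) × the rank index `Fin 19`. -/
def G1Tᵣ : Matrix (Fin 10 ⊕ Fin 9) (Fin 19) ℚ := fun i l => G1litᵣ (e1 i) l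
/-- `H` on the typed channel index × the rank index. -/
def HTᵣ : Matrix ((Fin 10 × Fin 10) ⊕ (Fin 10 × Fin 10)) (Fin 19) ℚ :=
  fun k l => Sum.elim (fun pq : Fin 10 × Fin 10 => Htabᵣ 0 pq.1 pq.2 l) (fun pq => Htabᵣ 1 pq.1 pq.2 l) k
/-- `Z₁₁` on the typed state index. -/
def Z11Qᵣ : Matrix (Fin 10 ⊕ Fin 9) (Fin 10 ⊕ Fin 9) ℚ := Z11litᵣ.submatrix e1 e1
/-- `Z₂₁` on the typed indices. -/
def Z21Qᵣ : Matrix ((Fin 10 × Fin 10) ⊕ (Fin 10 × Fin 10)) (Fin 10 ⊕ Fin 9) ℚ :=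
  fun k i => Sum.elim (fun pq : Fin 10 × Fin 10 => Z21tabᵣ 0 pq.1 pq.2 (e1 i)) (fun pq => Z21tabᵣ 1 pq.1 pq.2 (e1 i)) k
/-- `Z₂₂ := H·Hᵀ` (NEVER tabulated: only its diagonal enters a dual functional, because `C·B = 0`). -/
def Z22Qᵣ : Matrix ((Fin 10 × Fin 10) ⊕ (Fin 10 × Fin 10)) ((Fin 10 × Fin 10) ⊕ (Fin 10 × Fin 10)) ℚ := HTᵣ * HTᵣᵀ
/-- `a0` on the typed channel index. -/
def a0Kᵣ (k : (Fin 10 × Fin 10) ⊕ (Fin 10 × Fin 10)) : ℚ := Sum.elim (fun pq : Fin 10 × Fin 10 => a0Tabᵣ 0 pq.1 pq.2) (fun pq => a0Tabᵣ 1 pq.1 pq.2) k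
/-- `b0` on the typed channel index. -/
def b0Kᵣ (k : (Fin 10 × Fin 10) ⊕ (Fin 10 × Fin 10)) : ℚ := Sum.elim (fun pq : Fin 10 × Fin 10 => b0Tabᵣ 0 pq.1 pq.2) (fun pq => b0Tabᵣ 1 pq.1 pq.2) k
/-- The ordered pair `(p, q)` of a channel (either family). -/
def pairOfᵣ (k : (Fin 10 × Fin 10) ⊕ (Fin 10 × Fin 10)) : Fin 10 × Fin 10 := Sum.elim id id k
/-- `X` on the typed state index. -/
def XFᵣ (i j : Fin 10 ⊕ Fin 9) : ℚ := Xlitᵣ (e1 i) (e1 j)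
/-- `BZ` on the typed state index. -/
def BZFᵣ (i j : Fin 10 ⊕ Fin 9) : ℚ := BZlitᵣ (e1 i) (e1 j)
/-- `HD` on the typed state index. -/
def HDFᵣ (i j : Fin 10 ⊕ Fin 9) : ℚ := HDlitᵣ (e1 i) (e1 j)

/-! ### The tables ARE the Gram products / the formulas (kernel, entrywise over `ℚ`) -/

set_option maxHeartbeats 4000000 in
/-- **`Z11litᵣ = G1·G1ᵀ`** entrywise (kernel). -/
theorem Z11_eqᵣ : ∀ i j : Fin 19, Z11litᵣ i j = ∑ l : Fin 19, G1litᵣ i l * G1litᵣ j l := by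
  decide +kernel

set_option maxHeartbeats 40000000 in
/-- **`Z21tabᵣ = H·G1ᵀ`** entrywise, all 200 × 19 entries (kernel). -/
theorem Z21_eqᵣ : ∀ (k : (Fin 10 × Fin 10) ⊕ (Fin 10 × Fin 10)) (j : Fin 10 ⊕ Fin 9), Z21Qᵣ k j = ∑ l : Fin 19, HTᵣ k l * G1Tᵣ j l := by
  decide +kernel

set_option maxHeartbeats 4000000 in
/-- **`Xlitᵣ = Z₁₁Aᵀ + AZ₁₁`** entrywise (kernel). -/
theorem X_eqᵣ : ∀ i j : Fin 10 ⊕ Fin 9, XFᵣ i j =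
    (∑ l : Fin 10, Z11Qᵣ i (Sum.inl l) * AQ j (Sum.inl l) + ∑ l : Fin 9, Z11Qᵣ i (Sum.inr l) * AQ j (Sum.inr l))
      + (∑ l : Fin 10, AQ i (Sum.inl l) * Z11Qᵣ (Sum.inl l) j + ∑ l : Fin 9, AQ i (Sum.inr l) * Z11Qᵣ (Sum.inr l) j) := by
  decide +kernel

set_option maxHeartbeats 40000000 in
/-- **`BZlitᵣ = B·Z₂₁`** entrywise (kernel; `B = BLQ` rational, sum over the 200 channels). -/
theorem BZ_eqᵣ : ∀ i j : Fin 10 ⊕ Fin 9, BZFᵣ i j =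
    (∑ p : Fin 10, ∑ q : Fin 10, BLQ i (Sum.inl (p, q)) * Z21Qᵣ (Sum.inl (p, q)) j)
      + (∑ p : Fin 10, ∑ q : Fin 10, BLQ i (Sum.inr (p, q)) * Z21Qᵣ (Sum.inr (p, q)) j) := by
  decide +kernel

/-- **`HDlitᵣ = (X − 2BZ) + (X − 2BZ)ᵀ`** entrywise (kernel). -/
theorem HD_eqᵣ : ∀ i j : Fin 10 ⊕ Fin 9, HDFᵣ i j = (XFᵣ i j - 2 * BZFᵣ i j) + (XFᵣ j i - 2 * BZFᵣ j i) := by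
  decide +kernel

set_option maxHeartbeats 4000000 in
/-- **(D1) `HD = W + Wᵀ ⪰ 0`** (19 × 19 kernel `LDLᵀ` on the table). -/
theorem HD_ldlᵣ : PSD.LDLCert HDlitᵣ := by
  decide +kernel

/-! ### The typed matrix identities -/

/-- `Z₁₁ = G1·G1ᵀ` (typed). -/
theorem Z11Q_gramᵣ : Z11Qᵣ = G1Tᵣ * G1Tᵣᵀ := by
  ext i j
  rw [Matrix.mul_apply]
  exact Z11_eqᵣ (e1 i) (e1 j)

/-- `Z₂₁ = H·G1ᵀ` (typed). -/
theorem Z21Q_gramᵣ : Z21Qᵣ = HTᵣ * G1Tᵣᵀ := by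
  ext k j
  rw [Matrix.mul_apply]
  exact Z21_eqᵣ k j

/-- `X = Z₁₁Aᵀ + AZ₁₁` on the typed index (plumbing; `X` as in lit-6's `dualAdjP`). -/
def XQᵣ : Matrix (Fin 10 ⊕ Fin 9) (Fin 10 ⊕ Fin 9) ℚ := Z11Qᵣ * AQᵀ + AQ * Z11Qᵣ - (2 : ℚ) • (BLQ * Z21Qᵣ)

/-- `HQᵣ = X + Xᵀ` (typed formula). -/
def HQᵣ : Matrix (Fin 10 ⊕ Fin 9) (Fin 10 ⊕ Fin 9) ℚ := XQᵣ + XQᵣᵀ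

/-- `Z₁₁Aᵀ + AZ₁₁ = Xlitᵣ` (typed). -/
theorem XQ0_eqᵣ : Z11Qᵣ * AQᵀ + AQ * Z11Qᵣ = Xlitᵣ.submatrix e1 e1 := by
  ext i j
  rw [Matrix.submatrix_apply, show Xlitᵣ (e1 i) (e1 j) = XFᵣ i j from rfl, X_eqᵣ i j]
  simp only [Matrix.add_apply, Matrix.mul_apply, Matrix.transpose_apply, Fintype.sum_sum_type]

/-- `B·Z₂₁ = BZlitᵣ` (typed). -/
theorem BZQ_eqᵣ : BLQ * Z21Qᵣ = BZlitᵣ.submatrix e1 e1 := by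
  ext i j
  rw [Matrix.submatrix_apply, show BZlitᵣ (e1 i) (e1 j) = BZFᵣ i j from rfl, BZ_eqᵣ i j]
  simp only [Matrix.mul_apply, Fintype.sum_sum_type, Fintype.sum_prod_type]

/-- **`HQᵣ = HDlitᵣ`** (typed): the (D1) matrix of the witness IS the decided table. -/
theorem HQ_eqᵣ : HQᵣ = HDlitᵣ.submatrix e1 e1 := by
  ext i j
  rw [HQᵣ, XQᵣ, XQ0_eqᵣ, BZQ_eqᵣ, Matrix.submatrix_apply, show HDlitᵣ (e1 i) (e1 j) = HDFᵣ i j from rfl, HD_eqᵣ i j]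
  simp only [Matrix.add_apply, Matrix.sub_apply, Matrix.transpose_apply, Matrix.smul_apply, Matrix.submatrix_apply,
    smul_eq_mul, XFᵣ, BZFᵣ]

end Summit.Ventures.GridStability.Lyapunov.NE39LossySplitLinesRecDual
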